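import Mathlib
import HarnessLib
import Summits.HubbardSuperconductivity.HubbardSuperconductivity.Theorems.KLProgrammeH10TwoPointLimitSectorMultiplierJumpRegime
import Summits.HubbardSuperconductivity.HubbardSuperconductivity.Theorems.KLProgrammeKLRegimeEngineSectorisedKernelTransfer
import Summits.HubbardSuperconductivity.HubbardSuperconductivity.Theorems.KLProgrammeH10TwoPointLimitOverlapKernelCharSum

/-!
# Route `KLProgramme` — crux K3 ENGINE (stmt-HubbardSuperconductivity-20437 `KLRegimeEngineV17F2`), located risk #16 «ι₂-ANISO-LINE»:
# THE ANISOTROPIC ALL-FIXED FOUR-LEG LINE FROM THE PLAIN LINE (Young with the single-multiplier transfer sums), under the stub binders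
# (cell gate-hubbard-kl, seat hubbard-kl-k3c2-p3 g9; memo P2-IMPORT.md §2bis — the object of risk #16 is thereby the PLAIN pinned `L¹` line)

WHY.  The tower's four-leg import `μ k 2 ≤ ι₂·λ` is (anchored aniso count) × (aniso all-fixed line) (`…EngineTowerImportP2Count`, p585574).  The aniso
all-fixed line itself needs no sector-box smoothness: for ANY Grassmann element `G`, sectorising its four-leg kernel with the anisotropic family `F_n` is a
leg-by-leg transfer from the PLAIN (trivial one-sector family) kernel through `Θ = E(F_n)·S(1)`, whose column/row sums are the `ℓ¹` norms of the single
multipliers' position kernels `F̌_{n,ω}` — `O(1)` uniformly in the regime (the neighbouring-pair character sums of `…SectorMultiplierJumpRegime`, p554553,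
telescoped by `charSum_klAniso_single_le`, p549432).  So `fixedTupleL1(F_n)(G) ≤ CA⁴ · fixedTupleL1(plain)(G)` (the generic transfer bound
`fixedTupleL1_le_of_plateau_transfer`, k3c2-p2 p583258, with the trivial coarse family: plateau trivially, ONE parent string).

* §1 `charSum_klAniso_single_of_thresholds` — `∃ CT′ > 0`: under the absolute thresholds of `charSum_klAnisoPair_nb_of_thresholds`, every single multiplier
  `F_{n,ω}` (`1 ≤ n ≤ nScales β + 1`) has space-time character sum of `ℓ¹` norm `≤ CT′·M·L²`;
* §2 `transferSums_klAniso_of_thresholds` — `∃ CA > 0`: the column and row sums of `E(klAnisoFamily … n)·S(trivialMultiplier)` (labels matched) are `≤ CA/ε`;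
* §3 **`fixedTupleL1_klAniso_le_of_plain_of_thresholds`** — `∃ CA > 0`: for every `G`, every aniso label string and spin/charge strings, if the PLAIN four-leg
  kernel of `G` has pinned `L¹` size `≤ S` at every pin then the `F_n`-sectorised all-fixed pinned `L¹` size is `≤ CA⁴·S`;
  **`fixedTupleL1_klAniso_le_of_plain_klEng`** — the same under EXACTLY the binders of `stub_engine_step_norms` (`P.WF`, `R.WF2`, `c ≤ klEngC₃6`, `U ≤ klEngU₀9`,
  `klEngL₃ β U ≤ L`, `klEngM₃ β U L ≤ M`).
Consequence (memo P2-IMPORT §2bis): risk #16's producer target is a PLAIN pinned `L¹` line for the quartic of `𝒱_j[K_n]`; the aniso line and `ι₂` follow by name.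
Everything is proved; no definitions; nothing about the model is asserted; nothing asserts superconductivity.
References: BGM 2006 §2.7 (2.70)–(2.71a), §2.8 (2.76)–(2.77) [cite: BenfattoGiulianiMastropietro2006].
-/

noncomputable section

namespace Summit.HubbardSuperconductivity.HubbardSuperconductivity.Theorems.EngineV8

set_option linter.dupNamespace false -- summit = problem name (single-conjunct summit), D-0017

open Classical
open Real Finset Complex Literature.MathematicalPhysics.QuantumLattice Literature.Probability.LatticeModels GrassmannAlgebra
open Literature.MathematicalPhysics.QuantumLattice.BandSectorCounting
open Summit.HubbardSuperconductivity.HubbardSuperconductivity.Theorems.KLProgrammeLegKernels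
open Summit.HubbardSuperconductivity.HubbardSuperconductivity.Theorems.KLRegimeSplit
open Summit.HubbardSuperconductivity.HubbardSuperconductivity.Theorems.TorusFourierL2
open Summit.HubbardSuperconductivity.HubbardSuperconductivity.Theorems.DispersionFlow

/-! ## §1 The single-multiplier character sum in the regime -/

/-- **The single anisotropic multiplier's character sum in the KL regime** (absolute thresholds of `charSum_klAnisoPair_nb_of_thresholds`): `∃ CT′ > 0` with
`Σ_z ‖Σ_q χ_q(z) F_{n,ω}(k_q)‖ ≤ CT′·M·L²` for every `1 ≤ n ≤ nScales β + 1` and `ω` (`CT′ = 27·C_T`: the neighbouring-pair bound telescoped over the ≤ 27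
coarse partners). [cite: BenfattoGiulianiMastropietro2006, §2.7 (2.71a)] -/
theorem charSum_klAniso_single_of_thresholds (ha : (-4 : ℝ) < -(6 / 5)) (hab : (-(6 / 5) : ℝ) ≤ -(1 / 10)) (hb : (-(1 / 10) : ℝ) < 0) :
    ∃ CT' : ℝ, 0 < CT' ∧ ∀ (R : RenConsts), (∀ j, 0 ≤ R.Gfr j) →
      ∀ (c U : ℝ), 0 < c →
      c ≤ min (min ((bandBounds ha hab hb).Dtmin / 4) ((bandBounds ha hab hb).rhomin / 4)) (1 / 40) / (12 * (R.Gfr 2 + 1)) → 0 < U →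
      U ≤ min 1 (min (min ((bandBounds ha hab hb).Dtmin / 4) ((bandBounds ha hab hb).rhomin / 4)) (1 / 40) / (24 * (R.Gfr 0 + R.Gfr 1 + 1))) →
      ∀ β : ℝ, klBetaMin ≤ β → β ≤ Real.exp (c / U ^ 2) → ∀ μ ∈ klWindowC, ∀ K : TrigPolyC4v, FrameOK R U (nScales β) μ K →
      ∀ (L M : ℕ) [NeZero L] [NeZero M], β ^ 2 ≤ (L : ℝ) → β ≤ (M : ℝ) → ∀ n : ℕ, 1 ≤ n → n ≤ nScales β + 1 →
        ∀ ω : Fin (sectorCount n),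
          ∑ z : TorusSite 1 (2 * M) × TorusSite 2 L,
            ‖∑ q : TorusSite 1 (2 * M) × TorusSite 2 L, (torusChar q.1 z.1 * torusChar q.2 z.2) •
              klAnisoFamily L M β μ K klE0 n ω (⟨(q.1 0).val, ZMod.val_lt (q.1 0)⟩, q.2)‖ ≤ CT' * M * (L : ℝ) ^ 2 := by
  obtain ⟨CT, hCT, h⟩ := charSum_klAnisoPair_nb_of_thresholds ha hab hb
  refine ⟨27 * CT, by positivity, ?_⟩
  intro R hR c U hc hcκ hU hUκ β hβmin hβc μ hμ K hK L M _ _ hL hM n hn hnN ω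
  have hT0 : 0 ≤ CT * M * (L : ℝ) ^ 2 := by positivity
  have hsingle := charSum_klAniso_single_le (L := L) (M := M) β μ K hn ω hT0
    (fun a => h R hR c U hc hcκ hU hUκ β hβmin hβc μ hμ K hK L M hL hM n hn hnN ω a)
  linarith [hsingle]

/-! ## §2 The transfer sums of `E(F_n)·S(1)` -/

/-- **The transfer sums of the anisotropic family against the trivial family**: `∃ CA > 0` with, under the same thresholds, column AND row sums of
`E(klAnisoFamily … n)·S(trivialMultiplier)` (labels matched) `≤ CA/ε`, `ε = imagTimeWeight β M` (`overlapKernel_sums_le_of_charSum_le`).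
[cite: BenfattoGiulianiMastropietro2006, §2.7 (2.70)-(2.71a)] -/
theorem transferSums_klAniso_of_thresholds (ha : (-4 : ℝ) < -(6 / 5)) (hab : (-(6 / 5) : ℝ) ≤ -(1 / 10)) (hb : (-(1 / 10) : ℝ) < 0) :
    ∃ CA : ℝ, 0 < CA ∧ ∀ (R : RenConsts), (∀ j, 0 ≤ R.Gfr j) →
      ∀ (c U : ℝ), 0 < c →
      c ≤ min (min ((bandBounds ha hab hb).Dtmin / 4) ((bandBounds ha hab hb).rhomin / 4)) (1 / 40) / (12 * (R.Gfr 2 + 1)) → 0 < U →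
      U ≤ min 1 (min (min ((bandBounds ha hab hb).Dtmin / 4) ((bandBounds ha hab hb).rhomin / 4)) (1 / 40) / (24 * (R.Gfr 0 + R.Gfr 1 + 1))) →
      ∀ β : ℝ, klBetaMin ≤ β → β ≤ Real.exp (c / U ^ 2) → ∀ μ ∈ klWindowC, ∀ K : TrigPolyC4v, FrameOK R U (nScales β) μ K →
      ∀ (L M : ℕ) [NeZero L] [NeZero M], β ^ 2 ≤ (L : ℝ) → β ≤ (M : ℝ) → ∀ n : ℕ, 1 ≤ n → n ≤ nScales β + 1 →
        ∀ (ω : Fin (sectorCount n)) (s c' : Fin 2),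
          (∀ y : SpaceTimeIdx L M, ∑ x : SpaceTimeIdx L M,
            ‖(sectorAnalysisMatrix L M β (klAnisoFamily L M β μ K klE0 n) * sectorSubMatrix L M β (trivialMultiplier L M))
                (x, ((ω, s), c')) (y, (((0 : Fin 1), s), c'))‖ ≤ CA / imagTimeWeight β M) ∧
          (∀ x : SpaceTimeIdx L M, ∑ y : SpaceTimeIdx L M,
            ‖(sectorAnalysisMatrix L M β (klAnisoFamily L M β μ K klE0 n) * sectorSubMatrix L M β (trivialMultiplier L M))
                (x, ((ω, s), c')) (y, (((0 : Fin 1), s), c'))‖ ≤ CA / imagTimeWeight β M) := by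
  obtain ⟨CT', hCT', h⟩ := charSum_klAniso_single_of_thresholds ha hab hb
  refine ⟨CT' / 2, by positivity, ?_⟩
  intro R hR c U hc hcκ hU hUκ β hβmin hβc μ hμ K hK L M _ _ hL hM n hn hnN ω s c'
  have hβ : 0 < β := KLRegimeSplit.pos_of_klBetaMin_le hβmin
  have hT : ∀ (σ : Fin (sectorCount n)) (w : Fin 1), ∑ z : TorusSite 1 (2 * M) × TorusSite 2 L,
      ‖∑ q : TorusSite 1 (2 * M) × TorusSite 2 L, (torusChar q.1 z.1 * torusChar q.2 z.2) •
        (klAnisoFamily L M β μ K klE0 n σ (⟨(q.1 0).val, ZMod.val_lt (q.1 0)⟩, q.2) *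
          trivialMultiplier L M w (⟨(q.1 0).val, ZMod.val_lt (q.1 0)⟩, q.2))‖ ≤ CT' * M * (L : ℝ) ^ 2 := by
    intro σ w
    simp only [trivialMultiplier, mul_one]
    exact h R hR c U hc hcκ hU hUκ β hβmin hβc μ hμ K hK L M hL hM n hn hnN σ
  have hs := overlapKernel_sums_le_of_charSum_le hβ (klAnisoFamily L M β μ K klE0 n) (trivialMultiplier L M) hT
  have hLr : (L : ℝ) ≠ 0 := by exact_mod_cast NeZero.ne L
  have hMr : (0 : ℝ) < M := Nat.cast_pos.2 (Nat.pos_of_ne_zero (NeZero.ne M))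
  have hval : CT' * M * (L : ℝ) ^ 2 / (β * (L : ℝ) ^ 2) = CT' / 2 / imagTimeWeight β M := by
    rw [imagTimeWeight]
    field_simp
  exact ⟨fun y => (hs.2 ω 0 s c' y).trans (le_of_eq hval), fun x => (hs.1 ω 0 s c' x).trans (le_of_eq hval)⟩

/-! ## §3 The anisotropic all-fixed line from the plain line -/

/-- **ANISO ALL-FIXED LINE ≤ CA⁴ × PLAIN LINE** (absolute thresholds): `∃ CA > 0` such that, in the regime, for every Grassmann element `G`, scale
`1 ≤ n ≤ nScales β + 1`, label string `ω` and spin/charge strings `s, c`: if the PLAIN (trivial-family) four-leg kernel of `G` has pinned `L¹` size `≤ S` at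
every pin, then `fixedTupleL1 β 3 (W^{F_n}_4(G)) ((ω i, s i), c i) x₁ ≤ CA⁴·S`.  No smoothness of `Ĝ` on the sector box is used (Young with the
single-multiplier transfer sums). [cite: BenfattoGiulianiMastropietro2006, §2.7 (2.71a), §2.8 (2.76)-(2.77)] -/
theorem fixedTupleL1_klAniso_le_of_plain_of_thresholds (ha : (-4 : ℝ) < -(6 / 5)) (hab : (-(6 / 5) : ℝ) ≤ -(1 / 10)) (hb : (-(1 / 10) : ℝ) < 0) :
    ∃ CA : ℝ, 0 < CA ∧ ∀ (R : RenConsts), (∀ j, 0 ≤ R.Gfr j) →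
      ∀ (c U : ℝ), 0 < c →
      c ≤ min (min ((bandBounds ha hab hb).Dtmin / 4) ((bandBounds ha hab hb).rhomin / 4)) (1 / 40) / (12 * (R.Gfr 2 + 1)) → 0 < U →
      U ≤ min 1 (min (min ((bandBounds ha hab hb).Dtmin / 4) ((bandBounds ha hab hb).rhomin / 4)) (1 / 40) / (24 * (R.Gfr 0 + R.Gfr 1 + 1))) →
      ∀ β : ℝ, klBetaMin ≤ β → β ≤ Real.exp (c / U ^ 2) → ∀ μ ∈ klWindowC, ∀ K : TrigPolyC4v, FrameOK R U (nScales β) μ K →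
      ∀ (L M : ℕ) [NeZero L] [NeZero M], β ^ 2 ≤ (L : ℝ) → β ≤ (M : ℝ) → ∀ n : ℕ, 1 ≤ n → n ≤ nScales β + 1 →
        ∀ (G : HubbardGrassmann L M) (ω : Fin 4 → Fin (sectorCount n)) (s c' : Fin 4 → Fin 2) (S : ℝ), 0 ≤ S →
          (∀ y₀ : SpaceTimeIdx L M,
            fixedTupleL1 L M β 3 (sectorisedKernel L M β (trivialMultiplier L M) G 4) (fun i => (((0 : Fin 1), s i), c' i)) y₀ ≤ S) →
          ∀ x₁ : SpaceTimeIdx L M,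
            fixedTupleL1 L M β 3 (sectorisedKernel L M β (klAnisoFamily L M β μ K klE0 n) G 4) (fun i => ((ω i, s i), c' i)) x₁ ≤ CA ^ 4 * S := by
  obtain ⟨CA, hCA, h⟩ := transferSums_klAniso_of_thresholds ha hab hb
  refine ⟨CA, hCA, ?_⟩
  intro R hR c U hc hcκ hU hUκ β hβmin hβc μ hμ K hK L M _ _ hL hM n hn hnN G ω s c' S hS0 hS x₁
  have hβ : 0 < β := KLRegimeSplit.pos_of_klBetaMin_le hβmin
  set F' := klAnisoFamily L M β μ K klE0 n with hF'
  set Ω' : Fin 4 → SectorLeg (sectorCount n) := fun i => ((ω i, s i), c' i) with hΩ'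
  -- plateau: the trivial family sums to one everywhere
  have hpl : ∀ (i : Fin 4) (k : FreqMomentum L M), F' (Ω' i).1.1 k ≠ 0 → ∑ w, trivialMultiplier L M w k = 1 := by
    intro i k _
    simp [trivialMultiplier]
  -- the single parent string
  have hParout : ∀ σ : Fin 4 → Fin 1, σ ∉ (univ : Finset (Fin 4 → Fin 1)) → ∃ i, ∀ k, F' (Ω' i).1.1 k * trivialMultiplier L M (σ i) k = 0 :=
    fun σ hσ => absurd (mem_univ σ) hσ
  have hsum := fun i => h R hR c U hc hcκ hU hUκ β hβmin hβc μ hμ K hK L M hL hM n hn hnN (ω i) (s i) (c' i)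
  have hSpar : ∀ σ ∈ (univ : Finset (Fin 4 → Fin 1)), ∀ y₀ : SpaceTimeIdx L M,
      fixedTupleL1 L M β 3 (sectorisedKernel L M β (trivialMultiplier L M) G (3 + 1)) (fun i => ((σ i, (Ω' i).1.2), (Ω' i).2)) y₀ ≤ S := by
    intro σ _ y₀
    have hσ : σ = fun _ => 0 := funext fun i => Subsingleton.elim _ _
    subst hσ
    exact hS y₀
  have ht := fixedTupleL1_le_of_plateau_transfer hβ F' (trivialMultiplier L M) G Ω' hpl univ hParout hCA.le hS0
    (fun i y => (hsum i).1 y) (fun x => (hsum 0).2 x) hSpar x₁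
  have hcard : ((univ : Finset (Fin 4 → Fin 1)).card : ℝ) = 1 := by simp
  rw [hcard, one_mul] at ht
  exact ht

/-- **ANISO ALL-FIXED LINE ≤ CA⁴ × PLAIN LINE, UNDER EXACTLY THE BINDERS OF `stub_engine_step_norms`** (`P.WF`, `R.WF2`, `0 < c ≤ klEngC₃6 P R`, `μ ∈ klWindowC`,
`0 < U ≤ klEngU₀9 P R c`, `klBetaMin ≤ β ≤ e^{c/U²}`, `FrameOK R U (nScales β) μ K`, `klEngL₃ β U ≤ L`, `klEngM₃ β U L ≤ M`; the package thresholds sit below the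
absolute ones as in `overlap_jump_sums_klEng`): `∃ CA > 0` with, for every `1 ≤ n ≤ nScales β + 1`, `G`, strings and `S ≥ 0`: plain pinned `L¹ ≤ S` at every
pin ⇒ `F_n`-sectorised all-fixed pinned `L¹ ≤ CA⁴·S`. [cite: BenfattoGiulianiMastropietro2006, §2.7 (2.71a), §2.8 (2.76)-(2.77)] -/
theorem fixedTupleL1_klAniso_le_of_plain_klEng :
    ∃ CA : ℝ, 0 < CA ∧ ∀ (P : SplitConsts) (R : RenConsts) (c : ℝ), P.WF → R.WF2 → 0 < c → c ≤ klEngC₃6 P R →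
      ∀ μ ∈ klWindowC, ∀ U : ℝ, 0 < U → U ≤ klEngU₀9 P R c → ∀ β : ℝ, klBetaMin ≤ β → β ≤ Real.exp (c / U ^ 2) →
      ∀ K : TrigPolyC4v, FrameOK R U (nScales β) μ K → ∀ (L M : ℕ) [NeZero L] [NeZero M],
      klEngL₃ β U ≤ L → klEngM₃ β U L ≤ M → ∀ n : ℕ, 1 ≤ n → n ≤ nScales β + 1 →
        ∀ (G : HubbardGrassmann L M) (ω : Fin 4 → Fin (sectorCount n)) (s c' : Fin 4 → Fin 2) (S : ℝ), 0 ≤ S →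
          (∀ y₀ : SpaceTimeIdx L M,
            fixedTupleL1 L M β 3 (sectorisedKernel L M β (trivialMultiplier L M) G 4) (fun i => (((0 : Fin 1), s i), c' i)) y₀ ≤ S) →
          ∀ x₁ : SpaceTimeIdx L M,
            fixedTupleL1 L M β 3 (sectorisedKernel L M β (klAnisoFamily L M β μ K klE0 n) G 4) (fun i => ((ω i, s i), c' i)) x₁ ≤ CA ^ 4 * S := by
  have ha : (-4 : ℝ) < -(6 / 5) := by norm_num
  have hab : (-(6 / 5) : ℝ) ≤ -(1 / 10) := by norm_num
  have hb : (-(1 / 10) : ℝ) < 0 := by norm_num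
  obtain ⟨CA, hCA, h⟩ := fixedTupleL1_klAniso_le_of_plain_of_thresholds ha hab hb
  refine ⟨CA, hCA, ?_⟩
  intro P R c _ hR2 hc hc6 μ hμ U hU hU9 β hβmin hβc K hK L M _ _ hL3 hM3 n hn hnN G ω s c' S hS0 hS x₁
  have hRj : ∀ j, 0 ≤ R.Gfr j := gfr_nonneg_of_wf2 hR2
  exact h R hRj c U hc
    (hc6.trans ((klEngC₃6_le_klEngC₃3 P R).trans (klEngC₃3_le_symbolC₃ ha hab hb P hRj))) hU
    (hU9.trans ((klEngU₀9_le_klEngU₀3 P R c).trans (klEngU₀3_le_symbolU₀ ha hab hb P hRj c)))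
    β hβmin hβc μ hμ K hK L M (sq_le_of_klEngL₃_le hL3) (le_of_klEngM₃_le hβmin hL3 hM3) n hn hnN G ω s c' S hS0 hS x₁

end Summit.HubbardSuperconductivity.HubbardSuperconductivity.Theorems.EngineV8

end
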